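import Mathlib
import Summits.ValiantsHypothesis.ValiantsHypothesis.Theorems.GrenetZeonTwoDimCoefficientsDefs
import Summits.ValiantsHypothesis.ValiantsHypothesis.Theorems.GrenetZeonTwoDimCoefficientsUnitReducedRescale

/-!
# Crux `GrenetZeon.TwoDimCoefficients` (stmt-ValiantsHypothesis-8062), stub `stub_dualUnipotent`:
# the nilpotent-pencil normal form of a unipotent dual representation

The paper-level normal forms N1/N4 of `CALIBRATION-stub_dualUnipotent.md` (val-width-8062-p3),
typed.  If `per_n = α·det A + β·tr(adj A·B)` with `A`, `B` affine `m × m` over `ℂ[x_{ij}]` and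
`det A ≡ c ≠ 0` (`DualUnipotentRepr n m`), then, with `A₀ = A(0)`, `A = A₀(1 − N)` where `N` is a
matrix of LINEAR FORMS which is NILPOTENT, `N^m = 0` (`pow_eq_zero_of_isHomogeneous_one`: a
linear pencil `N` with `det(1 − N) = 1` has `det(1 − tN(x)) = 1` for all `t`, so every `N(x)` has
characteristic polynomial `X^m`), `adj A = c·(Σ_{i<m} N^i)·A₀⁻¹`, and comparing homogeneous
components of degree `n` (the permanent is a form of degree `n`):

  `per_n = tr(N^{n−1} · M)`,  `M = βc·(N A₀⁻¹ B(0) + A₀⁻¹ (B − B(0)))` a matrix of linear forms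

(`exists_nilpotent_pencil_of_dualUnipotentRepr`).  Consequences:

* `trace_prod_of_dualUnipotentRepr` — a unipotent dual representation of size `m` IS a trace
  product `per_n = tr(X₁ ⋯ X_n)` of `n` linear `m × m` matrices (`X₁ = ⋯ = X_{n−1} = N`,
  `X_n = M`).  Together with `dualUnipotentRepr_of_trace_prod` (`…DualUnipotentTraceProduct.lean`,
  trace product of width `w` ⟹ unipotent dual representation of size `n·w`) the two models are
  the same up to the factor `n` in the size.
* `dualUnipotentBound_of_trace_prod_width_sq` — hence a QUADRATIC trace-product width bound
  `n² ≤ C·w` for the permanent would imply the stub; with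
  `trace_prod_width_linear_of_dualUnipotentBound` (stub ⟹ linear bound `n ≤ C·w`) the stub
  `stub_dualUnipotent` is bracketed between the linear and the quadratic trace-product width lower
  bounds for `per_n`, both open (record: `n ≤ 2w²`, `le_two_mul_sq_of_trace_prod`).

HONEST FRAMING: bookkeeping inside the quadratic regime; the stub stays open; `VP ≠ VNP` is not
moved by anything here.

References: L. G. Valiant, *Completeness classes in algebra*, STOC 1979, §2 (`(I − N)⁻¹ = Σ N^i`
for nilpotent `N`); T. Mignon, N. Ressayre, Int. Math. Res. Not. 2004:79.
-/

-- single-conjunct layout `Summits/ValiantsHypothesis/ValiantsHypothesis`: the duplicated namespace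
-- component is mandated by the tree.
set_option linter.dupNamespace false

noncomputable section

namespace Summit.ValiantsHypothesis.ValiantsHypothesis.Cruxes.TwoDimCoefficients.DimTwoCases

open Literature.Computability.AlgebraicComplexity Matrix MvPolynomial

/-! ### Homogeneity bookkeeping for matrices of forms -/

section Homog

variable {σ : Type*} {ι : Type*}

/-- Entries of a product of matrices of forms of degrees `a` and `b` are forms of degree `a + b`.
[folklore] -/
theorem isHomogeneous_mul_apply [Fintype ι] {P Q : Matrix ι ι (MvPolynomial σ ℂ)} {a b : ℕ}
    (hP : ∀ i j, (P i j).IsHomogeneous a) (hQ : ∀ i j, (Q i j).IsHomogeneous b) (i j : ι) :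
    ((P * Q) i j).IsHomogeneous (a + b) := by
  rw [Matrix.mul_apply]
  exact IsHomogeneous.sum _ _ _ fun k _ => (hP i k).mul (hQ k j)

/-- Entries of a constant matrix are forms of degree `0`. [folklore] -/
theorem isHomogeneous_map_C_apply (G : Matrix ι ι ℂ) (i j : ι) :
    ((G.map MvPolynomial.C : Matrix ι ι (MvPolynomial σ ℂ)) i j).IsHomogeneous 0 :=
  isHomogeneous_C _ _

/-- Entries of the `k`-th power of a matrix of linear forms are forms of degree `k`. [folklore] -/
theorem isHomogeneous_pow_apply [Fintype ι] [DecidableEq ι] {N : Matrix ι ι (MvPolynomial σ ℂ)}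
    (hN : ∀ i j, (N i j).IsHomogeneous 1) : ∀ (k : ℕ) (i j : ι), ((N ^ k) i j).IsHomogeneous k := by
  intro k
  induction k with
  | zero =>
    intro i j
    rw [pow_zero]
    by_cases hij : i = j
    · subst hij
      rw [Matrix.one_apply_eq]
      exact isHomogeneous_one σ ℂ
    · rw [Matrix.one_apply_ne hij]
      exact isHomogeneous_zero σ ℂ 0
  | succ k ih =>
    intro i j
    rw [pow_succ]
    exact isHomogeneous_mul_apply ih hN i j

/-- The trace of a matrix of forms of degree `a` is a form of degree `a`. [folklore] -/
theorem isHomogeneous_trace [Fintype ι] {P : Matrix ι ι (MvPolynomial σ ℂ)} {a : ℕ}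
    (hP : ∀ i j, (P i j).IsHomogeneous a) : P.trace.IsHomogeneous a :=
  IsHomogeneous.sum _ _ _ fun i _ => hP i i

/-- The homogeneous component of degree `n` of a form of degree `a`. [folklore] -/
theorem homogeneousComponent_of_isHomogeneous {φ : MvPolynomial σ ℂ} {a : ℕ}
    (hφ : φ.IsHomogeneous a) (n : ℕ) :
    homogeneousComponent n φ = if n = a then φ else 0 :=
  homogeneousComponent_of_mem ((mem_homogeneousSubmodule a φ).2 hφ)

end Homog

/-! ### A unipotent LINEAR pencil is nilpotent -/

section Pencil

variable {σ : Type*} [Fintype σ] {m : ℕ}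

/-- **A unipotent linear pencil is nilpotent.**  If every entry of the `m × m` matrix `N` over
`ℂ[x]` is a linear form and `det (1 − N) = 1`, then `N ^ m = 0`: by homogeneity
`det (1 − t·N(x)) = 1` for every point `x` and scalar `t`, so `N(x)` has characteristic polynomial
`X^m` and `N(x)^m = 0` (Cayley–Hamilton) at every point. [folklore] -/
theorem pow_eq_zero_of_isHomogeneous_one (N : Matrix (Fin m) (Fin m) (MvPolynomial σ ℂ))
    (hN : ∀ i j, (N i j).IsHomogeneous 1) (hdet : (1 - N).det = 1) : N ^ m = 0 := by
  -- pointwise nilpotency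
  have hpt : ∀ x : σ → ℂ, (N.map (eval x)) ^ m = 0 := by
    intro x
    set Nx : Matrix (Fin m) (Fin m) ℂ := N.map (eval x) with hNx
    -- `det (1 − t • Nx) = 1` for all `t`
    have hdt : ∀ t : ℂ, (1 - t • Nx).det = 1 := by
      intro t
      have hmap : (1 - N).map (eval (t • x)) = 1 - t • Nx := by
        ext i j
        rw [Matrix.map_apply, Matrix.sub_apply, Matrix.sub_apply, Matrix.smul_apply, hNx,
          Matrix.map_apply, map_sub, eval_smul_of_isHomogeneous _ (hN i j), pow_one, smul_eq_mul]
        by_cases hij : i = j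
        · subst hij; simp
        · simp [Matrix.one_apply_ne hij]
      have h := RingHom.map_det (eval (t • x)) (1 - N)
      rw [hdet, map_one, RingHom.mapMatrix_apply, hmap] at h
      exact h.symm
    -- hence `charpoly Nx = X ^ m`
    have hchar : Nx.charpoly = Polynomial.X ^ m := by
      apply Polynomial.eq_of_infinite_eval_eq
      have hinf : Set.Infinite ({0}ᶜ : Set ℂ) := (Set.finite_singleton (0 : ℂ)).infinite_compl
      refine hinf.mono fun s hs => ?_
      have hs0 : s ≠ 0 := fun h => hs (Set.mem_singleton_iff.2 h)
      rw [Set.mem_setOf_eq, Matrix.eval_charpoly, Polynomial.eval_pow, Polynomial.eval_X]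
      have hsc : (Matrix.scalar (Fin m)) s - Nx = s • (1 - s⁻¹ • Nx) := by
        rw [smul_sub, smul_smul, mul_inv_cancel₀ hs0, one_smul, Matrix.scalar_apply,
          ← Matrix.smul_one_eq_diagonal]
      rw [hsc, Matrix.det_smul, hdt, mul_one, Fintype.card_fin]
    have h := Matrix.aeval_self_charpoly Nx
    rwa [hchar, map_pow, Polynomial.aeval_X] at h
  -- a polynomial matrix vanishing at every point vanishes
  refine Matrix.ext fun i j => MvPolynomial.funext fun x => ?_
  have h := congrArg (fun P : Matrix (Fin m) (Fin m) ℂ => P i j) (hpt x)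
  simp only [Matrix.zero_apply] at h
  rw [Matrix.zero_apply, map_zero, ← h, ← RingHom.mapMatrix_apply, ← map_pow,
    RingHom.mapMatrix_apply, Matrix.map_apply]

end Pencil

/-! ### The normal form -/

section NormalForm

variable {n m : ℕ}

/-- The adjugate of a matrix with unit determinant is `det • inverse`. [folklore] -/
theorem adjugate_eq_det_smul_inv {R : Type*} [CommRing R] {k : ℕ} (A : Matrix (Fin k) (Fin k) R)
    (h : IsUnit A.det) : A.adjugate = A.det • A⁻¹ := by
  rw [Matrix.inv_def, smul_smul, Ring.mul_inverse_cancel _ h, one_smul]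

/-- **Nilpotent-pencil normal form (N1/N4 of the calibration memo).**  A unipotent dual
representation of `per_n` of size `m` (`n ≥ 1`) yields matrices `N`, `M` of LINEAR FORMS, `N`
nilpotent (`N^m = 0`), with `per_n = tr(N^{n−1}·M)`. [folklore] -/
theorem exists_nilpotent_pencil_of_dualUnipotentRepr (hn : 1 ≤ n) (h : DualUnipotentRepr n m) :
    ∃ N M : AffMat n m, (∀ i j, (N i j).IsHomogeneous 1) ∧ (∀ i j, (M i j).IsHomogeneous 1) ∧
      N ^ m = 0 ∧ perPoly (Fin n) ℂ = (N ^ (n - 1) * M).trace := by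
  obtain ⟨α, β, c, A, B, hA, hB, hc, hdet, hper⟩ := h
  obtain ⟨k, rfl⟩ : ∃ k, n = k + 1 := ⟨n - 1, by omega⟩
  simp only [Nat.add_sub_cancel]
  -- constant parts
  set A₀ : Matrix (Fin m) (Fin m) ℂ := A.map constantCoeff with hA₀
  set B₀ : Matrix (Fin m) (Fin m) ℂ := B.map constantCoeff with hB₀
  have hA₀det : A₀.det = c := by
    have h := RingHom.map_det (constantCoeff : MvPolynomial (Fin (k + 1) × Fin (k + 1)) ℂ →+* ℂ) A
    rw [hdet, constantCoeff_C, RingHom.mapMatrix_apply] at h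
    exact h.symm
  have hA₀u : IsUnit A₀.det := by rw [hA₀det]; exact isUnit_iff_ne_zero.2 hc
  set G : Matrix (Fin m) (Fin m) ℂ := A₀⁻¹ with hG
  have hGA : G * A₀ = 1 := Matrix.nonsing_inv_mul A₀ hA₀u
  have hAG : A₀ * G = 1 := Matrix.mul_nonsing_inv A₀ hA₀u
  -- lifts to polynomial matrices
  set A₀C : AffMat (k + 1) m := A₀.map MvPolynomial.C with hA₀C
  set B₀C : AffMat (k + 1) m := B₀.map MvPolynomial.C with hB₀C
  set GC : AffMat (k + 1) m := G.map MvPolynomial.C with hGC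
  have hGAC : GC * A₀C = 1 := by
    rw [hGC, hA₀C, ← RingHom.mapMatrix_apply, ← RingHom.mapMatrix_apply, ← map_mul, hGA, map_one]
  have hAGC : A₀C * GC = 1 := by
    rw [hGC, hA₀C, ← RingHom.mapMatrix_apply, ← RingHom.mapMatrix_apply, ← map_mul, hAG, map_one]
  -- linear parts
  set A₁ : AffMat (k + 1) m := A - A₀C with hA₁
  set B₁ : AffMat (k + 1) m := B - B₀C with hB₁
  have hA₁h : ∀ i j, (A₁ i j).IsHomogeneous 1 := by
    intro i j
    rw [hA₁, Matrix.sub_apply, hA₀C, Matrix.map_apply, hA₀, Matrix.map_apply, constantCoeff_eq]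
    exact isHomogeneous_one_sub_C_coeff_zero _ (hA i j)
  have hB₁h : ∀ i j, (B₁ i j).IsHomogeneous 1 := by
    intro i j
    rw [hB₁, Matrix.sub_apply, hB₀C, Matrix.map_apply, hB₀, Matrix.map_apply, constantCoeff_eq]
    exact isHomogeneous_one_sub_C_coeff_zero _ (hB i j)
  -- the pencil
  set N : AffMat (k + 1) m := -(GC * A₁) with hN
  have hNh : ∀ i j, (N i j).IsHomogeneous 1 := by
    intro i j
    rw [hN, Matrix.neg_apply]
    refine IsHomogeneous.neg ?_
    have := isHomogeneous_mul_apply (isHomogeneous_map_C_apply G) hA₁h i j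
    rwa [zero_add] at this
  have hAfac : A = A₀C * (1 - N) := by
    rw [hN, sub_neg_eq_add, Matrix.mul_add, Matrix.mul_one, ← Matrix.mul_assoc, hAGC,
      Matrix.one_mul, hA₁, add_sub_cancel]
  have hdet1 : (1 - N).det = 1 := by
    have h1 : A.det = MvPolynomial.C c * (1 - N).det := by
      rw [hAfac, Matrix.det_mul, hA₀C, ← RingHom.mapMatrix_apply, ← RingHom.map_det, hA₀det]
    have hCc : (MvPolynomial.C c : MvPolynomial (Fin (k + 1) × Fin (k + 1)) ℂ) ≠ 0 := by
      rwa [Ne, C_eq_zero]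
    apply mul_left_cancel₀ hCc
    rw [← h1, hdet, mul_one]
  have hNm : N ^ m = 0 := pow_eq_zero_of_isHomogeneous_one N hNh hdet1
  -- the inverse and the adjugate of `A`
  set S : AffMat (k + 1) m := ∑ i ∈ Finset.range m, N ^ i with hS
  have hNS : (1 - N) * S = 1 := by rw [hS, mul_neg_geom_sum, hNm, sub_zero]
  have hAinv : A⁻¹ = S * GC := by
    apply Matrix.inv_eq_right_inv
    rw [hAfac, Matrix.mul_assoc, ← Matrix.mul_assoc (1 - N), hNS, Matrix.one_mul, hAGC]
  have hAu : IsUnit A.det := by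
    rw [hdet]; exact (isUnit_iff_ne_zero.2 hc).map MvPolynomial.C
  have hadj : A.adjugate = (MvPolynomial.C c : MvPolynomial (Fin (k + 1) × Fin (k + 1)) ℂ) • (S * GC) := by
    rw [adjugate_eq_det_smul_inv A hAu, hdet, hAinv]
  -- the trace, term by term
  have hBdec : B = B₀C + B₁ := by rw [hB₁, add_sub_cancel]
  have htr : (A.adjugate * B).trace = MvPolynomial.C c *
      ∑ i ∈ Finset.range m, ((N ^ i * GC * B₀C).trace + (N ^ i * GC * B₁).trace) := by
    rw [hadj, Matrix.smul_mul, Matrix.trace_smul, smul_eq_mul, hS, Finset.sum_mul,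
      Finset.sum_mul, Matrix.trace_sum]
    congr 1
    refine Finset.sum_congr rfl fun i _ => ?_
    rw [← Matrix.trace_add, ← Matrix.mul_add, ← hBdec]
  -- degrees of the terms
  have hT : ∀ i, ((N ^ i * GC * B₀C).trace).IsHomogeneous i := by
    intro i
    refine isHomogeneous_trace fun a b => ?_
    have h1 := isHomogeneous_mul_apply (isHomogeneous_pow_apply hNh i) (isHomogeneous_map_C_apply G)
    have h2 := isHomogeneous_mul_apply h1 (isHomogeneous_map_C_apply B₀) a b
    simpa using h2
  have hT' : ∀ i, ((N ^ i * GC * B₁).trace).IsHomogeneous (i + 1) := by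
    intro i
    refine isHomogeneous_trace fun a b => ?_
    have h1 := isHomogeneous_mul_apply (isHomogeneous_pow_apply hNh i) (isHomogeneous_map_C_apply G)
    have h2 := isHomogeneous_mul_apply h1 hB₁h a b
    simpa using h2
  -- extend the range so that the indices `k` and `k + 1` are present
  set K : ℕ := m + k + 2 with hK
  have hext : ∑ i ∈ Finset.range m, ((N ^ i * GC * B₀C).trace + (N ^ i * GC * B₁).trace) =
      ∑ i ∈ Finset.range K, ((N ^ i * GC * B₀C).trace + (N ^ i * GC * B₁).trace) := by
    refine Finset.sum_subset (Finset.range_subset_range.2 (by omega)) fun i hi hi' => ?_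
    have hmi : m ≤ i := by
      rw [Finset.mem_range] at hi hi'
      omega
    have hNi : N ^ i = 0 := by
      rw [← Nat.sub_add_cancel hmi, pow_add, hNm, mul_zero]
    rw [hNi, Matrix.zero_mul, Matrix.zero_mul, Matrix.zero_mul, Matrix.trace_zero, add_zero]
  -- take the homogeneous component of degree `k + 1`
  have hcomp := congrArg (homogeneousComponent (k + 1)) hper
  have hperh : (perPoly (Fin (k + 1)) ℂ).IsHomogeneous (k + 1) := by
    simpa [Fintype.card_fin] using perPoly_isHomogeneous (n := Fin (k + 1)) (k := ℂ)
  rw [homogeneousComponent_of_isHomogeneous hperh, if_pos rfl] at hcomp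
  rw [hcomp, htr, hext, hdet, ← map_mul, map_add, homogeneousComponent_of_isHomogeneous
    (isHomogeneous_C _ (α * c)) (k + 1), if_neg (Nat.succ_ne_zero k), zero_add,
    homogeneousComponent_C_mul, homogeneousComponent_C_mul, map_sum]
  simp_rw [map_add, homogeneousComponent_of_isHomogeneous (hT _),
    homogeneousComponent_of_isHomogeneous (hT' _), Finset.sum_add_distrib, Finset.sum_ite_eq,
    Finset.mem_range]
  rw [if_pos (by omega), Finset.sum_eq_single k]
  · rw [if_pos rfl]
    refine ⟨N, (MvPolynomial.C (β * c) : MvPolynomial (Fin (k + 1) × Fin (k + 1)) ℂ) •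
      (N * GC * B₀C + GC * B₁), hNh, ?_, hNm, ?_⟩
    · intro i j
      rw [Matrix.smul_apply, smul_eq_mul]
      refine IsHomogeneous.C_mul ?_ _
      rw [Matrix.add_apply]
      refine IsHomogeneous.add ?_ ?_
      · have h1 := isHomogeneous_mul_apply hNh (isHomogeneous_map_C_apply G)
        have h2 := isHomogeneous_mul_apply h1 (isHomogeneous_map_C_apply B₀) i j
        simpa using h2
      · have h2 := isHomogeneous_mul_apply (isHomogeneous_map_C_apply G) hB₁h i j
        simpa using h2
    · rw [Matrix.mul_smul, Matrix.trace_smul, smul_eq_mul, Matrix.mul_add, Matrix.trace_add,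
        pow_succ, Matrix.mul_assoc, Matrix.mul_assoc, Matrix.mul_assoc, Matrix.mul_assoc, map_mul,
        mul_assoc]
  · intro i _ hi
    rw [if_neg]
    omega
  · intro hk
    exact absurd (Finset.mem_range.2 (by omega)) hk

/-- **A unipotent dual representation of size `m` is a trace product of width `m`:**
`per_n = tr(X₁ ⋯ X_n)` with `X₁ = ⋯ = X_{n−1} = N` and `X_n = M` matrices of linear forms
(`n ≥ 1`).  Converse direction of `dualUnipotentRepr_of_trace_prod`
(`…DualUnipotentTraceProduct.lean`), which embeds a width-`w` trace product at size `n·w`.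
[folklore] -/
theorem trace_prod_of_dualUnipotentRepr (hn : 1 ≤ n) (h : DualUnipotentRepr n m) :
    ∃ X : Fin n → AffMat n m, (∀ i, IsAffine (X i)) ∧ (∀ i a b, (X i a b).IsHomogeneous 1) ∧
      perPoly (Fin n) ℂ = ((List.ofFn X).prod).trace := by
  obtain ⟨N, M, hN, hM, -, hper⟩ := exists_nilpotent_pencil_of_dualUnipotentRepr hn h
  obtain ⟨k, rfl⟩ : ∃ k, n = k + 1 := ⟨n - 1, by omega⟩
  simp only [Nat.add_sub_cancel] at hper
  have hhom : ∀ (i : Fin (k + 1)) a b, ((Fin.snoc (fun _ : Fin k => N) M : Fin (k + 1) → AffMat (k + 1) m)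
      i a b).IsHomogeneous 1 := by
    intro i a b
    rcases Fin.eq_castSucc_or_eq_last i with ⟨j, rfl⟩ | rfl
    · rw [Fin.snoc_castSucc]; exact hN a b
    · rw [Fin.snoc_last]; exact hM a b
  refine ⟨Fin.snoc (fun _ : Fin k => N) M, fun i a b => (hhom i a b).totalDegree_le, hhom, ?_⟩
  rw [hper, List.ofFn_succ', List.concat_eq_append, List.prod_append, List.prod_singleton]
  simp only [Fin.snoc_castSucc, Fin.snoc_last, List.ofFn_const, List.prod_replicate]

/-- **CALIBRATION (converse direction): a QUADRATIC trace-product width bound implies the stub.**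
If `per_n = tr(X₁ ⋯ X_n)` with affine `w × w` factors forced `n² ≤ C·w` (`n ≥ n₀`), then
`DualUnipotentBound` would hold (with the same `C`).  With
`trace_prod_width_linear_of_dualUnipotentBound` the stub sits between the linear and the
quadratic trace-product width lower bounds for the permanent. [folklore] -/
theorem dualUnipotentBound_of_trace_prod_width_sq
    (H : ∃ C n₀ : ℕ, ∀ n ≥ n₀, ∀ (w : ℕ) (X : Fin n → AffMat n w), (∀ i, IsAffine (X i)) →
      perPoly (Fin n) ℂ = ((List.ofFn X).prod).trace → n ^ 2 ≤ C * w) :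
    DualUnipotentBound := by
  obtain ⟨C, n₀, hC⟩ := H
  refine ⟨C, max n₀ 1, fun n hn m hrep => ?_⟩
  obtain ⟨X, hX, -, hper⟩ := trace_prod_of_dualUnipotentRepr (le_of_max_le_right hn) hrep
  exact hC n (le_of_max_le_left hn) m X hX hper

end NormalForm

end Summit.ValiantsHypothesis.ValiantsHypothesis.Cruxes.TwoDimCoefficients.DimTwoCases

end
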